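import Summits.Ventures.ResidMod.Mod2A5bVerdict
import HarnessLib

/-!
# Venture ResidMod — census-row verdict for the flag T-2b (Thm. 8.3.2 with SEMISTABLE reduction at `2`):
# GAL5 from Euler factors at odd primes; the local slots at `2` stay binders

HONEST FRAMING. Interface file of a COMPUTATION cell (`pub-residmod`). NO surface is claimed modular;
the cited theorem (BCGP 2025 Thm. 8.3.2, named fact `bcgp_residuallyA5b_modular_abelianSurface`) is the
hypothesis `h832`. This is the variant of `modular_of_mod2EulerCertificate` for curves WITHOUT good
reduction at `2` (the cell's class T-2b, PLAN R10: semistable ordinary reduction at `2`, `2`-distinguished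
— decided by the engines from the stable model / toric data, "Method T"): there is no good Euler factor at
`2`, so hypothesis (3) of Thm. 8.3.2 is passed VERBATIM as the two binders `hss` (inertia at `2` acts
unipotently of echelon `≤ 2` on every `V_ℓ(A)`, `ℓ ≠ 2` — Grothendieck's semistable reduction theorem in
Galois form) and `hord` (every framed dual of `V₂(A)` ordinary and `2`-distinguished, Def. 1.8.10); GAL5
is still DERIVED in the kernel from two good Euler factors at odd primes, and CONJ from `hcc`.

* `modular_of_mod2RowSemistable` — binders `F`, `hcc`, `hss`, `hord`; Euler factors `L_{q₅}` (odd/odd),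
  `L_{q₃}` (odd/even); fact `h832` ⟹ every framed dual of every `V_p(A)` is `IsAutomorphicAE`.

References: [BoxerCalegariGeePilloni2025] arXiv:2502.20645 Thm. 8.3.2 (3), Def. 1.8.10, Def. 9.1.7,
Lemma 9.1.8; [GrothendieckSGA7IX] Exp. IX §3.5; [BrumerEtAl2019] (4.1.5).
-/

noncomputable section

namespace Summit.Ventures.ResidMod

open Equiv Field IsDedekindDomain Polynomial
open scoped NumberField
open Literature.NumberTheory.GaloisRepresentations Literature.NumberTheory.Automorphic
open Literature.NumberTheory.Automorphic.Paramodular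
open Literature.NumberTheory.DiophantineGeometry Literature.NumberTheory.FaltingsSerre
open Literature.AlgebraicGeometry.Motives (AbelianVariety)

/-- **T-2b census row (semistable at `2`).**  Binders: Weierstrass `2`-torsion frame `F`, `hcc`, and
hypothesis (3) of Thm. 8.3.2 verbatim (`hss`, `hord`); Euler factors at odd `q₅` (`a,b` odd) and `q₃`
(`a` odd, `b` even) give GAL5 in the kernel; fact `h832`. Conclusion: every framed dual of every `V_p(A)`
is `IsAutomorphicAE`. CONDITIONAL on `h832`; every datum a binder. [cite: BoxerCalegariGeePilloni2025, Thm. 8.3.2; §8.1] -/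
theorem modular_of_mod2RowSemistable (h832 : bcgp_residuallyA5b_modular_abelianSurface)
    (A : AbelianVariety ℚ) (hA : A.dim = 2) (F : WeierstrassTwoTorsionFrame A)
    {q₅ : ℕ} (hq₅ : q₅.Prime) (hq₅2 : q₅ ≠ 2) {a₅ b₅ : ℤ}
    (hL₅ : A.HasGoodEulerFactorAt q₅ ((lPolynomialOfSurface q₅ a₅ b₅).map (Int.castRingHom ℚ)))
    (ha₅ : Odd a₅) (hb₅ : Odd b₅)
    {q₃ : ℕ} (hq₃ : q₃.Prime) (hq₃2 : q₃ ≠ 2) {a₃ b₃ : ℤ}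
    (hL₃ : A.HasGoodEulerFactorAt q₃ ((lPolynomialOfSurface q₃ a₃ b₃).map (Int.castRingHom ℚ)))
    (ha₃ : Odd a₃) (hb₃ : Even b₃)
    (hcc : ∀ c : absoluteGaloisGroup ℚ, IsComplexConjugation (algebraMap ℚ ℝ) c →
      (F.perm c).support.card = 4)
    (hss : ∀ (ℓ : ℕ) [Fact ℓ.Prime], ℓ ≠ 2 →
      ∀ v : HeightOneSpectrum (𝓞 ℚ), ((2 : ℕ) : 𝓞 ℚ) ∈ v.asIdeal →
        ∀ τ ∈ absInertia (v.adicCompletion ℚ),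
          (A.rationalTateRep ℓ (absGaloisRestrict ℚ (v.adicCompletion ℚ) τ) - 1) ^ 2 = 0)
    (hord : ∀ (b₂ : Module.Basis (Fin 4) ℚ_[2] (A.rationalTateModule 2))
        (r₂ : FramedGaloisRep ℚ (PadicAlgCl 2) 4),
        (∀ g : absoluteGaloisGroup ℚ,
          (r₂ g).val =
            ((LinearMap.toMatrix b₂ b₂ (A.rationalTateRep 2 g⁻¹)).map
              (algebraMap ℚ_[2] (PadicAlgCl 2))).transpose) →
        ∀ v : HeightOneSpectrum (𝓞 ℚ), ((2 : ℕ) : 𝓞 ℚ) ∈ v.asIdeal →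
          r₂.IsOrdinaryPDistinguishedAt v) :
    ∀ (p : ℕ) [Fact p.Prime] (b : Module.Basis (Fin 4) ℚ_[p] (A.rationalTateModule p))
      (r : FramedGaloisRep ℚ (PadicAlgCl p) 4),
      (∀ g : absoluteGaloisGroup ℚ,
        (r g).val =
          ((LinearMap.toMatrix b b (A.rationalTateRep p g⁻¹)).map
            (algebraMap ℚ_[p] (PadicAlgCl p))).transpose) →
      ∀ (hcpt : isCompact_glFiniteIntegralLevel 4 ℚ) (ι : PadicAlgCl p ≃+* ℂ),
        IsAutomorphicAE ι hcpt r := by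
  haveI : Fact (Nat.Prime 2) := ⟨Nat.prime_two⟩
  obtain ⟨c, r₀, hframe⟩ := exists_isFrameOfTateRep hA 2
  exact modular_of_mod2Certificate h832 A hA F
    (exists_perm_pow_five_of_eulerData hA F.apply_smul hframe hq₅ hq₅2 hL₅ ha₅ hb₅)
    (exists_perm_pow_six_of_eulerData hA F.apply_smul hframe hq₃ hq₃2 hL₃ ha₃ hb₃) hcc hss hord

end Summit.Ventures.ResidMod

end
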